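import Summits.BirchSwinnertonDyer.Rank1Residual.X4.PlusFunctionalModP
import Summits.BirchSwinnertonDyer.Rank1Residual.X4.PathFunctionExactOfCycles
import Summits.BirchSwinnertonDyer.BirchSwinnertonDyer.Theorems.SelmerRankSelmerRankLBStubDeltaParityLemmas
import HarnessLib

/-!
# The mod-`p^e` plus functional of a rational newform on `S₂(Γ₀(N))^∨`, and the FREE decomposition read ON CYCLES: `Ψ = Λ₁∘(α¹−w₁β¹)_* + Λ₂∘(α²−w₂β²)_*` on `H₁(X₀(N), ℤ)` gives the path identity `\overline{[r]⁺_f} = (α r − w₁α(ℓ₁r)) + (β r − w₂β(ℓ₂r))` with the path functions `α, β` of `Λ₁, Λ₂` (cell `b2b-bsdres`, seat additive-p4 gen 32, line V54/V55-A1–A2)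

HONEST FRAMING (verbatim, cell `b2b-bsdres`): the goal of the cell is to DELETE the COMBINATION-SHAPED
residual classes for ALL analytic-rank `≤ 1` curves over `ℚ` — "full BSD formula for every rank `≤ 1`
curve in class `C`" assembled STRICTLY from published theorems — so that the rank-`≤ 1` remainder
becomes exactly the CONSTRUCTION-SHAPED classes, which are TYPED (missing-input Props), NOT attempted;
this is not "finishing BSD". This file: TOOL theorems (modular symbols / period homology), 0 defs, 0
facts, nothing booked; X4 CONSTRUCTION-SHAPED.

## What is proved

* **`exists_plusFunctionalModPow`** — gen 26's `X4/PlusFunctionalModP.exists_plusFunctional` at the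
  modulus `p^e`: for a normalised rational newform `f ∈ S₂(Γ₀(N))` all of whose plus symbols are
  `p`-integral (`‖[r]⁺_f‖_p ≤ 1`; automatic for `f = f_E`, `p` odd, `E[p]` irreducible —
  `Additive.norm_ratPlusSymbol_le_one_of_irreducible`), there are an additive subgroup
  `P ⊇ H₁(X₀(N), ℤ) ∪ {σ r}` of `S₂^∨`, stable under every `T_q`, and `Ψ : S₂^∨ → ℤ/p^e` additive on `P`
  with `Ψ(σ r) = ratModP (p^e) [r]⁺_f` and `Ψ(T_q • z) = a_q Ψ(z)` on `P` (`P = {z : re z(f)/Ω⁺_f is a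
  p-integral rational}`, `Ψ` = its reduction; `ratModP (p^e)` is additive / `ℤ`-linear on `p`-integral
  rationals, the tree's `deltaParity_ratModP_*`).
* **`decomposition_of_oldOnCycles`** — levels `M₁, M₂ ∣ N` (`M_i·1, M₁·ℓ₁, M₂·ℓ₂ ∣ N`), a closing prime
  `q₀ ≡ 1 (mod N)` with `(a − q₀ − 1)·u = 1`, `Ψ` additive on `P ⊇ H₁ ∪ {σ r}` with `Ψ(T_{q₀}•z) = a Ψ(z)`
  and `Ψ(σ r) = φ(r)`; if ON CYCLES `Ψ = Λ₁∘(α¹ − w₁β¹)_* + Λ₂∘(α² − w₂β²)_*` (`Λ_i` on `H₁(X₀(M_i))`,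
  any `k`-valued functions), then ON PATHS `φ(r) = (α r − w₁α(ℓ₁r)) + (β r − w₂β(ℓ₂r))` with
  `α(r) = u·Λ₁((T_{q₀}−q₀−1)•{∞,r}_{M₁})`, `β(r) = u·Λ₂((T_{q₀}−q₀−1)•{∞,r}_{M₂})` — the hypothesis `hsym`
  of `X4/KuriharaAdditiveCertificateOfExactness.plusSymbolLevelLowersAdditivelyModAt_of_exact` /
  `…TwistOfExactness.exists_families_of_exact` with `α ∈ P₁`, `β ∈ P₂` path functions (K92). PROOF:
  `Ψ((T_{q₀}−q₀−1){∞,r}) = (a − q₀ − 1)φ(r)` (additivity + Hecke on `P`) and `= (g − w₁g∘[ℓ₁]) +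
  (h − w₂h∘[ℓ₂])` for the unit-free path functions `g, h` (`pathFun_sub_smul_comp_eq'`).

With this file the FREE decomposition, too, is a statement ON CYCLES (per row: the instrument's
decomposition of E's symbol in the lattices `Ȳ_i`); together with K92/K94/K95 every structural input of
the additive certificate is a statement about functionals on `H₁` of the four modular curves.

## References

* B. Mazur, J. Tate, J. Teitelbaum, Invent. Math. 84 (1986), §I.4 (4.2), §I.8. [cite: MazurTateTeitelbaum1986Invent, §I.4 (4.2) and §I.8]
* J. E. Cremona, *Algorithms for modular elliptic curves* (1997), §2.1, §2.8. [cite: CremonaAlgorithms1997, §2.8]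
* Ju. I. Manin, Izv. Akad. Nauk SSSR 36 (1972), Cor. 3.6 (Manin–Drinfeld), Thm. 3.3 (20). [cite: Manin1972, Cor. 3.6]
-/

noncomputable section

open scoped MatrixGroups ModularForm

open CongruenceSubgroup Finset Matrix

open Literature.NumberTheory.EllipticCurves Literature.NumberTheory.EllipticCurves.ModularForms
  Literature.NumberTheory.EllipticCurves.ModularForms.HidaCohomology

open Literature.NumberTheory.DiophantineGeometry.Dioph (ratModP)

open Summit.BirchSwinnertonDyer.BirchSwinnertonDyer.Theorems (deltaParity_ratModP_add
  deltaParity_ratModP_intCast_mul deltaParity_norm_add_le deltaParity_norm_neg_le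
  deltaParity_norm_intCast_mul_le)

namespace Summit.BirchSwinnertonDyer.Rank1Residual.LevelLowering

/-! ### §1 The mod-`p^e` plus functional -/

section PlusFunctionalModPow

variable {p : ℕ} [hp : Fact p.Prime] {N : ℕ} [NeZero N]

/-- **THE MOD-`p^e` PLUS FUNCTIONAL** (see the module docstring): `P ∋ {∞, r}`, `P ⊇ H₁(X₀(N), ℤ)`,
`T_q`-stable; `Ψ : S₂^∨ → ℤ/p^e` additive on `P`, `Ψ({∞, r}) = ratModP (p^e) [r]⁺_f`,
`Ψ(T_q • z) = a_q Ψ(z)` on `P`. [cite: MazurTateTeitelbaum1986Invent, §I.4 (4.2) and §I.8]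
[cite: CremonaAlgorithms1997, §2.8] [cite: Manin1972, Cor. 3.6] -/
theorem exists_plusFunctionalModPow (e : ℕ) (f : CuspForm (Gamma0 N) 2) (hf : IsNewform0 f)
    (hQ : coeffField f = ⊥) (hint : ∀ r : ℚ, ‖((ratPlusSymbol f r : ℚ) : ℚ_[p])‖ ≤ 1)
    (θ : ℕ → ℤ) (hθ : ∀ q : ℕ, q.Prime → ((θ q : ℤ) : ℂ) = cuspCoeff f q)
    (σ : ℚ → Module.Dual ℂ (CuspForm (Gamma0 N) 2))
    (hσ : ∀ (r : ℚ) (h : CuspForm (Gamma0 N) 2), σ r h = modularSymbol h r) :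
    ∃ (P : AddSubgroup (Module.Dual ℂ (CuspForm (Gamma0 N) 2)))
      (Ψ : Module.Dual ℂ (CuspForm (Gamma0 N) 2) → ZMod (p ^ e)),
      (∀ r : ℚ, σ r ∈ P) ∧ periodHomology N ≤ P ∧
      (∀ (q : ℕ) (hq : q.Prime), ∀ z ∈ P, HeckeRing0.T N 2 q hq • z ∈ P) ∧
      (∀ x ∈ P, ∀ y ∈ P, Ψ (x + y) = Ψ x + Ψ y) ∧
      (∀ r : ℚ, Ψ (σ r) = ratModP (p ^ e) (ratPlusSymbol f r)) ∧
      ∀ (q : ℕ) (hq : q.Prime), ∀ z ∈ P, Ψ (HeckeRing0.T N 2 q hq • z) = (θ q : ZMod (p ^ e)) * Ψ z := by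
  classical
  -- the value `v z = re z(f) / Ω⁺_f` and its rational preimage
  obtain ⟨v, hv⟩ : ∃ v : Module.Dual ℂ (CuspForm (Gamma0 N) 2) → ℝ,
      ∀ z, v z = (z f).re / plusPeriod f := ⟨_, fun _ ↦ rfl⟩
  have hv_add : ∀ x y, v (x + y) = v x + v y := fun x y ↦ by
    rw [hv, hv, hv, LinearMap.add_apply, Complex.add_re, add_div]
  have hv_T : ∀ (q : ℕ) (hq : q.Prime) (z : Module.Dual ℂ (CuspForm (Gamma0 N) 2)),
      v (HeckeRing0.T N 2 q hq • z) = (θ q : ℝ) * v z := by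
    intro q hq z
    haveI : NeZero q := ⟨hq.ne_zero⟩
    have hT : HeckeRing0.toEnd N 2 (HeckeRing0.T N 2 q hq) f = ((θ q : ℤ) : ℂ) • f := by
      rw [HeckeRing0.toEnd_T, hf.heckeT_eq_coeff_smul hq]
      exact congrArg (· • f) (hθ q hq).symm
    rw [hv, hv, HeckeRing0.smul_dual_apply, hT, map_smul, smul_eq_mul,
      show ((θ q : ℤ) : ℂ) = ((θ q : ℝ) : ℂ) by norm_cast, Complex.re_ofReal_mul, mul_div_assoc]
  have hv_σ : ∀ r : ℚ, v (σ r) = (ratPlusSymbol f r : ℝ) := fun r ↦ by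
    rw [hv, hσ, ratCast_ratPlusSymbol_holds hf hQ r, normalizedPlusSymbol,
      plusSymbol_eq_re_holds f hf.cuspCoeff_im_eq_zero r, Complex.ofReal_re]
  -- `P = {z : v z is a p-integral rational}`
  let P : AddSubgroup (Module.Dual ℂ (CuspForm (Gamma0 N) 2)) :=
    { carrier := {z | ∃ x : ℚ, ‖((x : ℚ) : ℚ_[p])‖ ≤ 1 ∧ v z = x}
      zero_mem' := ⟨0, by simp, by
        rw [hv, LinearMap.zero_apply, Complex.zero_re, zero_div, Rat.cast_zero]⟩
      add_mem' := by
        rintro x y ⟨a, ha, hxa⟩ ⟨b, hb, hyb⟩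
        exact ⟨a + b, deltaParity_norm_add_le ha hb, by rw [hv_add, hxa, hyb, Rat.cast_add]⟩
      neg_mem' := by
        rintro x ⟨a, ha, hxa⟩
        refine ⟨-a, deltaParity_norm_neg_le ha, ?_⟩
        have h := hv_add x (-x)
        rw [add_neg_cancel, hv, LinearMap.zero_apply, Complex.zero_re, zero_div] at h
        rw [Rat.cast_neg, ← hxa]
        linarith }
  have hP : ∀ z, z ∈ P ↔ ∃ x : ℚ, ‖((x : ℚ) : ℚ_[p])‖ ≤ 1 ∧ v z = x := fun z ↦ Iff.rfl
  -- `Ψ z = (rational value of v z) reduced modulo p^e`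
  obtain ⟨Ψ, hΨ⟩ : ∃ Ψ : Module.Dual ℂ (CuspForm (Gamma0 N) 2) → ZMod (p ^ e),
      ∀ z, Ψ z = ratModP (p ^ e) (Function.invFun ((↑) : ℚ → ℝ) (v z)) := ⟨_, fun _ ↦ rfl⟩
  have hinv : ∀ x : ℚ, Function.invFun ((↑) : ℚ → ℝ) (x : ℝ) = x :=
    Function.leftInverse_invFun Rat.cast_injective
  have hΨv : ∀ z (x : ℚ), v z = x → Ψ z = ratModP (p ^ e) x := fun z x h ↦ by
    rw [hΨ, h, hinv]
  have hσP : ∀ r : ℚ, σ r ∈ P := fun r ↦ (hP _).mpr ⟨ratPlusSymbol f r, hint r, hv_σ r⟩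
  have hTP : ∀ (q : ℕ) (hq : q.Prime), ∀ z ∈ P, HeckeRing0.T N 2 q hq • z ∈ P := by
    intro q hq z hz
    obtain ⟨x, hx, hzx⟩ := (hP z).mp hz
    refine (hP _).mpr ⟨(θ q : ℚ) * x, deltaParity_norm_intCast_mul_le (θ q) hx, ?_⟩
    rw [hv_T q hq z, hzx]
    push_cast
    ring
  refine ⟨P, Ψ, hσP, ?_, hTP, ?_, fun r ↦ hΨv _ _ (hv_σ r), ?_⟩
  · -- `H₁(X₀(N), ℤ) ≤ P`: every period functional is a symbol functional (or `0`)
    rw [periodHomology, AddSubgroup.closure_le]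
    rintro _ ⟨γ, rfl⟩
    by_cases hc : (γ : SL(2, ℤ)) 1 0 = 0
    · rw [periodFunctional_eq_zero_of_apply_eq_zero γ hc]
      exact P.zero_mem
    · have e' : periodFunctional N γ =
          σ ((((γ : SL(2, ℤ)) 0 0 : ℤ) : ℚ) / (((γ : SL(2, ℤ)) 1 0 : ℤ) : ℚ)) := by
        ext h
        rw [periodFunctional_apply, cuspSymbol, if_neg hc, hσ]
      rw [SetLike.mem_coe, e']
      exact hσP _
  · -- additivity on `P`
    intro x hx y hy
    obtain ⟨a, ha, hxa⟩ := (hP x).mp hx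
    obtain ⟨b, hb, hyb⟩ := (hP y).mp hy
    rw [hΨv x a hxa, hΨv y b hyb, hΨv (x + y) (a + b) (by rw [hv_add, hxa, hyb, Rat.cast_add]),
      deltaParity_ratModP_add e ha hb]
  · -- Hecke
    intro q hq z hz
    obtain ⟨x, hx, hzx⟩ := (hP z).mp hz
    rw [hΨv z x hzx, hΨv _ ((θ q : ℚ) * x) (by rw [hv_T q hq z, hzx]; push_cast; ring),
      deltaParity_ratModP_intCast_mul e _ hx]

end PlusFunctionalModPow

/-! ### §2 The FREE decomposition read on cycles ⟹ the path identity -/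

section DecompositionOfCycles

variable {k : Type*} [CommRing k]

/-- **FREE DECOMPOSITION ON CYCLES ⟹ ON PATHS** (see the module docstring). The conclusion is the
hypothesis `hsym` of the additive certificate with `α(r) = u·Λ₁((T_{q₀}−q₀−1)•{∞,r}_{M₁})`,
`β(r) = u·Λ₂((T_{q₀}−q₀−1)•{∞,r}_{M₂})`. [cite: Manin1972, Cor. 3.6] [cite: MazurTateTeitelbaum1986Invent, §I.4 (4.2) and §I.8] -/
theorem decomposition_of_oldOnCycles {M₁ M₂ N ℓ₁ ℓ₂ : ℕ} [NeZero M₁] [NeZero M₂] [NeZero N]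
    [NeZero ℓ₁] [NeZero ℓ₂]
    (h1N : M₁ * 1 ∣ N) (h1N' : M₁ * ℓ₁ ∣ N) (h2N : M₂ * 1 ∣ N) (h2N' : M₂ * ℓ₂ ∣ N)
    (σ1 : ℚ → Module.Dual ℂ (CuspForm (Gamma0 M₁) 2))
    (hσ1 : ∀ (r : ℚ) (f : CuspForm (Gamma0 M₁) 2), σ1 r f = modularSymbol f r)
    (σ2 : ℚ → Module.Dual ℂ (CuspForm (Gamma0 M₂) 2))
    (hσ2 : ∀ (r : ℚ) (f : CuspForm (Gamma0 M₂) 2), σ2 r f = modularSymbol f r)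
    (σN : ℚ → Module.Dual ℂ (CuspForm (Gamma0 N) 2))
    (hσN : ∀ (r : ℚ) (f : CuspForm (Gamma0 N) 2), σN r f = modularSymbol f r)
    {q₀ : ℕ} (hq₀ : q₀.Prime) (hq₀1 : q₀ ≡ 1 [MOD N]) (hq₀N : ¬ q₀ ∣ N)
    (P : AddSubgroup (Module.Dual ℂ (CuspForm (Gamma0 N) 2))) (Ψ : Module.Dual ℂ (CuspForm (Gamma0 N) 2) → k)
    (hσP : ∀ r : ℚ, σN r ∈ P) (hHP : periodHomology N ≤ P)
    (hΨadd : ∀ x ∈ P, ∀ y ∈ P, Ψ (x + y) = Ψ x + Ψ y)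
    {a : k} (hΨT : ∀ z ∈ P, Ψ (HeckeRing0.T N 2 q₀ hq₀ • z) = a * Ψ z)
    (φ : ℚ → k) (hΨσ : ∀ r : ℚ, Ψ (σN r) = φ r)
    {u : k} (hu : (a - ((q₀ + 1 : ℕ) : k)) * u = 1) (w₁ w₂ : k)
    (Λ₁ : Module.Dual ℂ (CuspForm (Gamma0 M₁) 2) → k) (Λ₂ : Module.Dual ℂ (CuspForm (Gamma0 M₂) 2) → k)
    (hold : ∀ y ∈ periodHomology N, Ψ y =
      (Λ₁ ((degeneracyMap0 M₁ N 1 2).dualMap y) - w₁ * Λ₁ ((degeneracyMap0 M₁ N ℓ₁ 2).dualMap y)) +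
      (Λ₂ ((degeneracyMap0 M₂ N 1 2).dualMap y) - w₂ * Λ₂ ((degeneracyMap0 M₂ N ℓ₂ 2).dualMap y)))
    (α β : ℚ → k)
    (hα : ∀ r, α r = u * Λ₁ (HeckeRing0.T M₁ 2 q₀ hq₀ • σ1 r - ((q₀ + 1 : ℕ) : ℂ) • σ1 r))
    (hβ : ∀ r, β r = u * Λ₂ (HeckeRing0.T M₂ 2 q₀ hq₀ • σ2 r - ((q₀ + 1 : ℕ) : ℂ) • σ2 r)) :
    ∀ r : ℚ, φ r = (α r - w₁ * α (ℓ₁ * r)) + (β r - w₂ * β (ℓ₂ * r)) := by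
  intro r
  -- the closed symbol and its value under `Ψ`
  have hcl : HeckeRing0.T N 2 q₀ hq₀ • σN r - ((q₀ + 1 : ℕ) : ℂ) • σN r ∈ periodHomology N :=
    T_smul_sub_smul_symbol_mem_periodHomology N σN hσN hq₀ hq₀1 r
  have hnsP : ((q₀ + 1 : ℕ) : ℂ) • σN r ∈ P := by
    rw [Nat.cast_smul_eq_nsmul]; exact P.nsmul_mem (hσP r) _
  have hΨcl : Ψ (HeckeRing0.T N 2 q₀ hq₀ • σN r - ((q₀ + 1 : ℕ) : ℂ) • σN r) =
      (a - ((q₀ + 1 : ℕ) : k)) * φ r := by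
    -- `T•σ = (A σ) + (q₀+1)•σ`, all in `P`
    have hsum := hΨadd _ (hHP hcl) _ hnsP
    rw [sub_add_cancel, hΨT _ (hσP r), apply_natCast_smul_of_additiveOn Ψ hΨadd (hσP r), hΨσ] at hsum
    linear_combination -hsum
  -- the same value through the decomposition on cycles and the path functions
  have e1 := pathFun_sub_smul_comp_eq' h1N h1N' Λ₁ σ1 hσ1 σN hσN hq₀ hq₀N u w₁ α hα r
  have e2 := pathFun_sub_smul_comp_eq' h2N h2N' Λ₂ σ2 hσ2 σN hσN hq₀ hq₀N u w₂ β hβ r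
  simp only at e1 e2
  have hdec := hold _ hcl
  rw [hΨcl] at hdec
  -- `φ r = u (a − q₀ − 1) φ r`
  have hφ : φ r = u * ((a - ((q₀ + 1 : ℕ) : k)) * φ r) := by
    rw [← mul_assoc, mul_comm u, hu, one_mul]
  rw [hφ, hdec, e1, e2]
  ring

end DecompositionOfCycles

end Summit.BirchSwinnertonDyer.Rank1Residual.LevelLowering

end
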